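/-
Copyright (c) 2026. All rights reserved.
Released under Apache 2.0 license as described in the file LICENSE.
Authors: abc-iut cell, prover seat abc-iut-w5-d017 (wave 5, gen 5).
-/
import Summits.ABC.IUTFork.Cor312Ind3IteratesVacuityWild
import Literature.IUT.LogVolume.UnitLogRamificationCriterion
import HarnessLib

/-!
# (Ind3) honest iterates at ODD residue characteristic: depth `≥ 2` is inhabited ⟺ `p_v ∣ e(v|p_v)`

Proof-only sequel (theorems, no definitions) of the honest-model census of the [IUTchIII] log-link iterates
(abc-iut-w4-d029's `Real.nonarchIterImage (analyticLogv F) v m′` over `Cor312Ind3RealIterates`, with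
abc-iut-c312-5's ANALYTIC logarithms `Real.analyticLogv`), which so far read (census of record,
abc-iut-w5-d172 2026-08-26): the depth-`≥ 2` images are EMPTY at every finite place `v` with
`e(v|p_v) ≤ p_v − 1` (`Real.nonarchIterImage_add_two_eq_empty`, p414009), at `(p, e) = (3, 4)`
(`…WildEmpty`) and at `(2, 2, f = 1)` (`…WildDyadic`), and INHABITED at every place over an odd `p` whose
completion contains a `p`-th root of `p` (`…Wild`, `…WildOddPrime`) — "the exact per-place criterion is
«depth `≥ 2` empty ⟺ no `log_v(u)` is a unit», NOT a function of `e` vs `p_v`".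

THIS FILE shows that at every ODD residue characteristic it IS a function of `e(v|p_v)` alone, namely of
the single bit `p_v ∣ e(v|p_v)`, by abc-iut-w5-d017's local criterion
`Literature.IUT.LogVolume.RamificationCriterion.logUnits_inter_sphere_nonempty_iff_dvd`
(`UnitLogRamificationCriterion.lean`: for odd `p`, `log_p(𝒪_K^×)` meets `𝒪_K^×` iff `p ∣ e(K/ℚ_p)`; for
every `p`, `p ∤ e ⇒` it does not) transported to the completions `F_v` through abc-iut-S7's rescaled
completion (`absRamificationIdx_rescaledCompletion : e(F_v) = e(v|p)`):

* `Real.nonarchIterImage_add_two_eq_empty_of_not_dvd` — **`p_v ∤ e(v|p_v)` (any `p_v`, `2` included)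
  ⇒ every honest depth-`≥ 2` image at `v` is EMPTY** (supersedes the hypothesis `e ≤ p_v − 1` of p414009
  and covers `(3, 4)`, `(2, odd e)`, …);
* `Real.nonarchIterImage_analyticLogv_two_nonempty_of_dvd` — **`p_v` odd, `p_v ∣ e(v|p_v)` ⇒ the depth-`2`
  image at `v` is INHABITED** (supersedes "contains a `p`-th root of `p`");
* `Real.nonarchIterImage_analyticLogv_two_nonempty_iff_dvd`,
  `Real.forall_nonarchIterImage_add_two_eq_empty_iff_not_dvd` — **the criterion** at odd `p_v`;
* packet level: `Real.tprodImages_honestU_add_two_eq_empty_of_not_dvd`,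
  `Column.unitImage_add_two_eq_empty_of_honestImages_of_not_dvd`.

What remains undecided by `e` alone: places over `2` with `2 ∣ e(v|2)` (there the residue degree enters:
`(2, 2, f = 1)` is empty by `…WildDyadic`).  Honest framing: statements ABOUT THE MODEL (which typed (Ind3)
containments are `∅ ⊆ _`); nothing here asserts or denies [IUTchIII] Cor. 3.12 or takes a side; census ≠
verdict; typed ≠ proved.  No definitions, no Prop-valued fact (D-0067 (1)).
-/

noncomputable section

open Set

namespace Summit.ABC.IUTFork.Thm311.Real

open NumberField IsDedekindDomain Literature.IUT.LogVolume Literature.IUT.LogThetaLattice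
  Literature.NumberTheory.NumberFields

variable {F : Type} [Field F] [NumberField F]

/-! ## 1. `p_v ∤ e(v|p_v)`: no analytic logarithm of a unit is a unit; depth `≥ 2` is empty -/

/-- **At a finite place `v` with `p_v ∤ e(v|p_v)`, `‖log_v(w)‖' ≠ 1` for every unit `w ∈ O_v^×`** (the
analytic logarithm = abc-iut-S1's `unitLog` in the rescaled completion, where `e(F_v) = e(v|p_v)`).
[cite: NeukirchANT1999, Ch. II (5.5)] -/
theorem norm_of_analyticLogv_ne_one_of_not_dvd (v : HeightOneSpectrum (𝓞 F))
    (he : ¬ residueChar F v ∣ v.asIdeal.ramificationIdx ℤ) (w : (↥(integers v))ˣ) :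
    ‖RescaledCompletion.of F (residueChar F v) v (natCast_residueChar_mem F v)
        (analyticLogv F v (Additive.ofMul w))‖ ≠ 1 := by
  haveI : Fact (residueChar F v).Prime := ⟨residueChar_prime F v⟩
  rw [analyticLogv_apply, RingEquiv.apply_symm_apply]
  refine RamificationCriterion.norm_unitLog_ne_one_of_not_dvd (residueChar F v) ?_ _
  rw [absRamificationIdx_rescaledCompletion]
  exact he

/-- **Hence no analytic logarithm of a unit is a unit of `O_v`** when `p_v ∤ e(v|p_v)`.
[cite: NeukirchANT1999, Ch. II (5.5)] -/
theorem analyticLogv_ne_coe_unit_of_not_dvd (v : HeightOneSpectrum (𝓞 F))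
    (he : ¬ residueChar F v ∣ v.asIdeal.ramificationIdx ℤ) (w u : (↥(integers v))ˣ) :
    analyticLogv F v (Additive.ofMul w) ≠ ((u : ↥(integers v)) : Carrier (.inr v : Place F)) := by
  intro h
  have h1 := norm_of_analyticLogv_ne_one_of_not_dvd v he w
  rw [h] at h1
  exact h1 (norm_of_coe_unit_adicCompletionIntegers F (residueChar F v) v (natCast_residueChar_mem F v) u)

/-- **`p_v ∤ e(v|p_v)` ⇒ the honest iterate image of depth `m′ + 2` at `v` is EMPTY** — for EVERY residue
characteristic (at `p_v = 2`: every place with ODD `e(v|2)`).  Supersedes the hypothesis `e(v|p_v) ≤ p_v − 1`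
of `Real.nonarchIterImage_add_two_eq_empty`. [claim: Mochizuki2012, status: disputed] -/
theorem nonarchIterImage_add_two_eq_empty_of_not_dvd (v : HeightOneSpectrum (𝓞 F))
    (he : ¬ residueChar F v ∣ v.asIdeal.ramificationIdx ℤ) (k : ℕ) :
    nonarchIterImage (analyticLogv F) v (k + 2) = ∅ := by
  ext z
  simp only [mem_empty_iff_false, iff_false]
  rintro ⟨u, hu, -⟩
  obtain ⟨w, hw⟩ := nonarchIterImage_succ_subset_range (analyticLogv F) v k hu
  exact analyticLogv_ne_coe_unit_of_not_dvd v he w u hw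

/-- The same for every depth `m′ ≥ 2`. [claim: Mochizuki2012, status: disputed] -/
theorem nonarchIterImage_eq_empty_of_two_le_of_not_dvd (v : HeightOneSpectrum (𝓞 F))
    (he : ¬ residueChar F v ∣ v.asIdeal.ramificationIdx ℤ) {m' : ℕ} (hm' : 2 ≤ m') :
    nonarchIterImage (analyticLogv F) v m' = ∅ := by
  obtain ⟨k, rfl⟩ := Nat.exists_eq_add_of_le' hm'
  exact nonarchIterImage_add_two_eq_empty_of_not_dvd v he k

/-- The per-place honest family at depth `≥ 2` is empty at such `v`. [claim: Mochizuki2012, status: disputed] -/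
theorem iterImage_add_two_inr_eq_empty_of_not_dvd (v : HeightOneSpectrum (𝓞 F))
    (he : ¬ residueChar F v ∣ v.asIdeal.ramificationIdx ℤ) (k : ℕ) :
    iterImage (analyticLogv F) (k + 2) (.inr v : Place F) = ∅ :=
  nonarchIterImage_add_two_eq_empty_of_not_dvd v he k

/-! ## 2. `p_v` odd, `p_v ∣ e(v|p_v)`: depth `2` is inhabited -/

/-- In the rescaled completion at a place over an odd `p` with `p ∣ e(v|p)` there is an element of norm `1`
whose `p`-adic logarithm has norm `1` (abc-iut-w5-d017's `exists_norm_unitLog_eq_one_of_dvd`, the unit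
`1 − ϖ^{e/p}`). [cite: NeukirchANT1999, Ch. II (5.5)] -/
theorem exists_norm_rescaled_and_unitLog_eq_one_of_dvd (v : HeightOneSpectrum (𝓞 F)) (p : ℕ)
    [Fact p.Prime] (hv : ((p : ℕ) : 𝓞 F) ∈ v.asIdeal) (hp2 : p ≠ 2) (he : p ∣ v.asIdeal.ramificationIdx ℤ) :
    ∃ y : v.adicCompletion F, ‖RescaledCompletion.of F p v hv y‖ = 1 ∧
      ‖unitLog (RescaledCompletion.of F p v hv y)‖ = 1 := by
  have he' : p ∣ absRamificationIdx p (RescaledCompletion F p v hv) := by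
    rwa [absRamificationIdx_rescaledCompletion]
  obtain ⟨u, hu, hlog⟩ := RamificationCriterion.exists_norm_unitLog_eq_one_of_dvd p hp2 he'
  exact ⟨(RescaledCompletion.of F p v hv).symm u, by rwa [RingEquiv.apply_symm_apply],
    by rwa [RingEquiv.apply_symm_apply]⟩

/-- **At a finite place `v` with `p_v` ODD and `p_v ∣ e(v|p_v)`, the honest depth-`2` nonarchimedean (Ind3)
iterate image for the analytic logarithms is NONEMPTY** (some unit `w ∈ O_v^×` has `log_v(w) ∈ O_v^×`, so
`log_v(log_v(w))` is a depth-`2` element; p415013's `nonarchIterImage_two_nonempty_of_exists_eq_coe_unit`).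
[claim: Mochizuki2012, status: disputed] -/
theorem nonarchIterImage_analyticLogv_two_nonempty_of_dvd (v : HeightOneSpectrum (𝓞 F))
    (hp2 : residueChar F v ≠ 2) (he : residueChar F v ∣ v.asIdeal.ramificationIdx ℤ) :
    (nonarchIterImage (analyticLogv F) v 2).Nonempty := by
  haveI : Fact (residueChar F v).Prime := ⟨residueChar_prime F v⟩
  obtain ⟨y, hy1, hylog⟩ := exists_norm_rescaled_and_unitLog_eq_one_of_dvd v (residueChar F v)
    (natCast_residueChar_mem F v) hp2 he
  obtain ⟨w, hw⟩ := exists_unit_coe_eq_of_norm_rescaled_eq_one v (residueChar F v)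
    (natCast_residueChar_mem F v) y hy1
  have hlog : ‖RescaledCompletion.of F (residueChar F v) v (natCast_residueChar_mem F v)
      (analyticLogv F v (Additive.ofMul w))‖ = 1 := by
    rw [analyticLogv_apply, RingEquiv.apply_symm_apply, hw]
    exact hylog
  obtain ⟨u, hu⟩ := exists_unit_coe_eq_of_norm_rescaled_eq_one v (residueChar F v)
    (natCast_residueChar_mem F v) (analyticLogv F v (Additive.ofMul w)) hlog
  exact nonarchIterImage_two_nonempty_of_exists_eq_coe_unit (analyticLogv F) v ⟨w, u, hu.symm⟩

/-- … so the per-place honest family `Real.iterImage (analyticLogv F) 2` is nonempty at `v`.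
[claim: Mochizuki2012, status: disputed] -/
theorem iterImage_analyticLogv_two_inr_nonempty_of_dvd (v : HeightOneSpectrum (𝓞 F))
    (hp2 : residueChar F v ≠ 2) (he : residueChar F v ∣ v.asIdeal.ramificationIdx ℤ) :
    (iterImage (analyticLogv F) 2 (.inr v : Place F)).Nonempty :=
  nonarchIterImage_analyticLogv_two_nonempty_of_dvd v hp2 he

/-! ## 3. The criterion at odd residue characteristic -/

/-- **THE CRITERION (odd `p_v`)**: the honest depth-`2` (Ind3) iterate image at `v` is inhabited
**iff `p_v ∣ e(v|p_v)`**. [claim: Mochizuki2012, status: disputed] -/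
theorem nonarchIterImage_analyticLogv_two_nonempty_iff_dvd (v : HeightOneSpectrum (𝓞 F))
    (hp2 : residueChar F v ≠ 2) :
    (nonarchIterImage (analyticLogv F) v 2).Nonempty ↔ residueChar F v ∣ v.asIdeal.ramificationIdx ℤ := by
  refine ⟨fun h ↦ ?_, nonarchIterImage_analyticLogv_two_nonempty_of_dvd v hp2⟩
  by_contra he
  rw [nonarchIterImage_add_two_eq_empty_of_not_dvd v he 0] at h
  exact Set.not_nonempty_empty h

/-- … equivalently: the depth-`2` image is EMPTY iff `p_v ∤ e(v|p_v)` (odd `p_v`).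
[claim: Mochizuki2012, status: disputed] -/
theorem nonarchIterImage_analyticLogv_two_eq_empty_iff_not_dvd (v : HeightOneSpectrum (𝓞 F))
    (hp2 : residueChar F v ≠ 2) :
    nonarchIterImage (analyticLogv F) v 2 = ∅ ↔ ¬ residueChar F v ∣ v.asIdeal.ramificationIdx ℤ := by
  rw [← Set.not_nonempty_iff_eq_empty, nonarchIterImage_analyticLogv_two_nonempty_iff_dvd v hp2]

/-- … and: EVERY depth-`≥ 2` image at `v` is empty iff `p_v ∤ e(v|p_v)` (odd `p_v`; the images decrease
with the depth only through depth `2`, which suffices). [claim: Mochizuki2012, status: disputed] -/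
theorem forall_nonarchIterImage_add_two_eq_empty_iff_not_dvd (v : HeightOneSpectrum (𝓞 F))
    (hp2 : residueChar F v ≠ 2) :
    (∀ k : ℕ, nonarchIterImage (analyticLogv F) v (k + 2) = ∅) ↔
      ¬ residueChar F v ∣ v.asIdeal.ramificationIdx ℤ := by
  refine ⟨fun h ↦ ?_, fun he k ↦ nonarchIterImage_add_two_eq_empty_of_not_dvd v he k⟩
  rw [← nonarchIterImage_analyticLogv_two_eq_empty_iff_not_dvd v hp2]
  exact h 0

/-! ## 4. Packet level: the honest unit-image clauses of depth `≥ 2` -/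

/-- The honest component family `honestU` of abc-iut-w4-d029 at depth `m′ + 2` is empty at a finite place
`w` of the fibre with `p_w ∤ e(w|p_w)`. [claim: Mochizuki2012, status: disputed] -/
theorem honestU_inr_add_two_eq_empty_of_not_dvd (X : PilotData F) (m : ℤ) (k : ℕ)
    {vQ : (thetaIndex X).VQ} (w : HeightOneSpectrum (𝓞 F)) (hw : (thetaIndex X).over (.inr w) = vQ)
    (he : ¬ residueChar F w ∣ w.asIdeal.ramificationIdx ℤ) :
    honestU X (analyticLogv F) m (k + 2) vQ ⟨.inr w, hw⟩ = ∅ :=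
  nonarchIterImage_add_two_eq_empty_of_not_dvd w he k

/-- **The pure-tensor unit image of the honest components at depth `m′ + 2` is EMPTY** at every `v_ℚ` over
which some place `w` of `F` has `p_w ∤ e(w|p_w)`. [claim: Mochizuki2012, status: disputed] -/
theorem tprodImages_honestU_add_two_eq_empty_of_not_dvd (X : PilotData F) (m : ℤ) (k : ℕ)
    (j : (thetaIndex X).Label) {vQ : (thetaIndex X).VQ}
    (w : HeightOneSpectrum (𝓞 F)) (hw : (thetaIndex X).over (.inr w) = vQ)
    (he : ¬ residueChar F w ∣ w.asIdeal.ramificationIdx ℤ) :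
    (logShellsDH X (analyticLogv F)).tprodImages j vQ (honestU X (analyticLogv F) m (k + 2) vQ) = ∅ :=
  LogShells.tprodImages_eq_empty_of_eq_empty _ j vQ _ ⟨.inr w, hw⟩
    (honestU_inr_add_two_eq_empty_of_not_dvd X m k w hw he)

/-- **Vacuity of the depth-`≥ 2` (Ind3) unit-image clauses in the honest model, divisibility form.** For any
column over `Real.logShellsDH X (analyticLogv F)` whose unit images are the pure-tensor images of the honest
components (hypothesis `hunit` of abc-iut-w4-d029): at every `(m, m′ + 2, j, v_ℚ)` with a place `w | v_ℚ` of
`F` such that `p_w ∤ e(w|p_w)`, the unit image is `∅` — so (Ind3) there reads `∅ ⊆ _`.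
[claim: Mochizuki2012, status: disputed] -/
theorem _root_.Summit.ABC.IUTFork.Thm311.Column.unitImage_add_two_eq_empty_of_honestImages_of_not_dvd
    (X : PilotData F) (C : Column (logShellsDH X (analyticLogv F)))
    (hunit : ∀ (m : ℤ) (m' : ℕ) (j : (thetaIndex X).Label) (vQ : (thetaIndex X).VQ),
      C.unitImage m m' j vQ =
        (logShellsDH X (analyticLogv F)).tprodImages j vQ (honestU X (analyticLogv F) m m' vQ))
    (m : ℤ) (k : ℕ) (j : (thetaIndex X).Label) {vQ : (thetaIndex X).VQ}
    (w : HeightOneSpectrum (𝓞 F)) (hw : (thetaIndex X).over (.inr w) = vQ)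
    (he : ¬ residueChar F w ∣ w.asIdeal.ramificationIdx ℤ) :
    C.unitImage m (k + 2) j vQ = ∅ := by
  rw [hunit]
  exact tprodImages_honestU_add_two_eq_empty_of_not_dvd X m k j w hw he

/-- **… and conversely, at an odd `v_ℚ = p` under a place `w` with `p ∣ e(w|p)`, the honest depth-`2`
component at `w` is INHABITED** (so the depth-`2` clause is not vacuous on that component).
[claim: Mochizuki2012, status: disputed] -/
theorem honestU_inr_two_nonempty_of_dvd (X : PilotData F) (m : ℤ) {vQ : (thetaIndex X).VQ}
    (w : HeightOneSpectrum (𝓞 F)) (hw : (thetaIndex X).over (.inr w) = vQ)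
    (hp2 : residueChar F w ≠ 2) (he : residueChar F w ∣ w.asIdeal.ramificationIdx ℤ) :
    (honestU X (analyticLogv F) m 2 vQ ⟨.inr w, hw⟩).Nonempty :=
  nonarchIterImage_analyticLogv_two_nonempty_of_dvd w hp2 he

end Summit.ABC.IUTFork.Thm311.Real

end
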